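import Mathlib
import Summits.AnomalousDissipation.AnomalousDissipation.Theses.DyadicWallCascade

/-!
# Stub `stub_slabExtension` of the line `Sketch` — crux `DyadicWallCascade.HalfSpaceHierarchy`
# (item stmt-AnomalousDissipation-18627): equivariant dyadic extension from the slab

Sorry-free discharge of the registered transfer stub `stub_slabExtension` of the lead's skeleton
(`Cruxes/HalfSpaceHierarchy/Lines/Sketch.lean`; the strategist's census decomposition D1,
`Cruxes/HalfSpaceHierarchy/CensusSignatures.lean`, `SlabExtension : SlabHierarchy → HalfSpaceHierarchy`).

**Statement.**  A *slab hierarchy* — `(V, Q, C, F)` with `V, Q` smooth and bounded by `C` on the OPEN slab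
`S = {1/2 < z < 4}` of `ℝ³` (`z = X 2`), divergence free and steady Euler there (`(V·∇)V + ∇Q = 0`),
`V (2X) = V X`, `Q (2X) = Q X` for `1/2 < z < 2`, `1`-periodic in `x, y` on the band `1 ≤ z ≤ 2`, zero mass flux
and energy flux `F ≠ 0` through the unit square of `{z = 1}` — extends to a *half-space hierarchy*, i.e. the crux
`HalfSpaceHierarchy` holds (same clauses on the whole open half-space `{z > 0}` with the full dilation invariance).

**Proof.**  The witnesses are the dyadic extensions `Ṽ X := V (2^{-k} X)`, `Q̃ X := Q (2^{-k} X)` with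
`k = ⌊log₂ X₃⌋` (`Int.log 2`), and the same `C, F`.  The one geometric fact is the AGREEMENT LEMMA
`slabExt_agree`: because `f (2Y) = f Y` for `1/2 < Y₃ < 2`, the extension agrees with `f ∘ (2^{-k} •)` on the
whole OPEN band `2^{k-1} < z < 2^{k+2}` (three cases `⌊log₂ z⌋ ∈ {k-1, k, k+1}`), and `2^{-k} •` maps that band into
the slab.  Hence, near every point of the half-space, `Ṽ = V ∘ L` with `L` a FIXED linear contraction
(`slabExt_eventuallyEq`): smoothness transfers (`slabExt_contDiffOn`, via `contDiffOn_of_locally_contDiffOn`),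
`DṼ(X) = 2^{-k} DV(2^{-k}X)` (`slabExt_fderiv`, chain rule) and `∇Q̃(X) = 2^{-k} ∇Q(2^{-k}X)`
(`slabExt_gradient`), so the divergence stays `0` and both terms of the Euler equation scale by the same factor
`2^{-k}`; the bounds hold because `2^{-k} X` lies in the band `1 ≤ z < 2 ⊂ S`; `Ṽ (2X) = Ṽ X` is the agreement
lemma on the band of `2X` plus one application of the slab relation; and on `1/2 < z < 4` the extension IS
`(V, Q)` (agreement with `k = 0`), which returns the periodicity clause and the two flux integrals verbatim.
No choice, no measure theory beyond rewriting the integrands.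

References: the census D1 (strategist seat `planner-cstrat-stmt-AnomalousDissipation-18627-s1-0`); the idea card
`Cruxes/HalfSpaceHierarchy/Ideas/octave-transfer-rpf.md` §Transfer ("extend by δ-equivariance"); folklore.
-/

-- `Summit.<Summit>.<Problem>` is the tree's mandated summit-side namespace (CONVENTIONS §2); for this
-- single-conjunct summit the two coincide, so the duplicate is deliberate.
set_option linter.dupNamespace false

-- `open`s at FILE level (before the section) so that the registered stub signature, which names the crux
-- `HalfSpaceHierarchy` unqualified, resolves everywhere in (and after) this file.
open scoped Topology InnerProductSpace
open MeasureTheory Filter Set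
open Summit.AnomalousDissipation.AnomalousDissipation.Theses.DyadicWallCascade

noncomputable section

namespace Summit.AnomalousDissipation.AnomalousDissipation.Theorems.HalfSpaceHierarchy


/-- Dyadic bracketing, lower half: `2 ^ ⌊log₂ z⌋ ≤ z` for `z > 0` (`Int.log`). -/
theorem slabExt_zpow_log_le {z : ℝ} (hz : 0 < z) : (2 : ℝ) ^ Int.log 2 z ≤ z := by
  have h := Int.zpow_log_le_self (b := 2) (r := z) one_lt_two hz
  simpa using h

/-- Dyadic bracketing, upper half: `z < 2 ^ (⌊log₂ z⌋ + 1)` (`Int.log`). -/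
theorem slabExt_lt_zpow_log_succ (z : ℝ) : z < (2 : ℝ) ^ (Int.log 2 z + 1) := by
  have h := Int.lt_zpow_succ_log_self (b := 2) one_lt_two z
  simpa using h

/-- The height coordinate `X ↦ X 2` is continuous on `ℝ³`. -/
theorem slabExt_continuous_height : Continuous fun X : EuclideanSpace ℝ (Fin 3) => X 2 :=
  (continuous_apply 2).comp (PiLp.continuous_ofLp 2 _)

/-- Open horizontal bands `{a < z < b}` are open. -/
theorem slabExt_isOpen_band (a b : ℝ) : IsOpen {Y : EuclideanSpace ℝ (Fin 3) | a < Y 2 ∧ Y 2 < b} :=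
  (isOpen_lt continuous_const slabExt_continuous_height).inter
    (isOpen_lt slabExt_continuous_height continuous_const)

/-- **Agreement lemma.** If `f (2Y) = f Y` whenever `1/2 < Y₃ < 2`, then the dyadic extension
`X ↦ f (2^{-⌊log₂ X₃⌋} X)` agrees with `f (2^{-k} ·)` on the whole open band `2^{k-1} < X₃ < 2^{k+2}`. -/
theorem slabExt_agree {α : Type*} (f : EuclideanSpace ℝ (Fin 3) → α)
    (hf : ∀ Y : EuclideanSpace ℝ (Fin 3), 1 / 2 < Y 2 → Y 2 < 2 → f ((2 : ℝ) • Y) = f Y)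
    {X : EuclideanSpace ℝ (Fin 3)} {k : ℤ} (h1 : (2 : ℝ) ^ (k - 1) < X 2) (h2 : X 2 < (2 : ℝ) ^ (k + 2)) :
    f (((2 : ℝ) ^ Int.log 2 (X 2))⁻¹ • X) = f (((2 : ℝ) ^ k)⁻¹ • X) := by
  have hz : 0 < X 2 := lt_trans (zpow_pos two_pos _) h1
  have hm1 : (2 : ℝ) ^ Int.log 2 (X 2) ≤ X 2 := slabExt_zpow_log_le hz
  have hm2 : X 2 < (2 : ℝ) ^ (Int.log 2 (X 2) + 1) := slabExt_lt_zpow_log_succ (X 2)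
  generalize Int.log 2 (X 2) = m at hm1 hm2
  have hlo : k - 1 < m + 1 := (zpow_lt_zpow_iff_right₀ (one_lt_two : (1 : ℝ) < 2)).1 (h1.trans hm2)
  have hhi : m < k + 2 := (zpow_lt_zpow_iff_right₀ (one_lt_two : (1 : ℝ) < 2)).1 (hm1.trans_lt h2)
  have hk : 0 < (2 : ℝ) ^ k := zpow_pos two_pos k
  rcases (show m = k - 1 ∨ m = k ∨ m = k + 1 by omega) with h | h | h
  · subst h
    have e1 : ((2 : ℝ) ^ (k - 1))⁻¹ • X = (2 : ℝ) • (((2 : ℝ) ^ k)⁻¹ • X) := by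
      rw [smul_smul, zpow_sub_one₀ two_ne_zero, mul_inv, inv_inv, mul_comm]
    rw [e1]
    apply hf
    · rw [PiLp.smul_apply, smul_eq_mul, lt_inv_mul_iff₀ hk]
      rw [zpow_sub_one₀ two_ne_zero] at h1
      linarith
    · rw [PiLp.smul_apply, smul_eq_mul, inv_mul_lt_iff₀ hk]
      rw [sub_add_cancel] at hm2
      linarith
  · subst h; rfl
  · subst h
    have hk1 : 0 < (2 : ℝ) ^ (k + 1) := zpow_pos two_pos (k + 1)
    have e1 : ((2 : ℝ) ^ k)⁻¹ • X = (2 : ℝ) • (((2 : ℝ) ^ (k + 1))⁻¹ • X) := by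
      rw [smul_smul, zpow_add_one₀ two_ne_zero, mul_inv]
      field_simp
    rw [e1, hf]
    · rw [PiLp.smul_apply, smul_eq_mul, lt_inv_mul_iff₀ hk1]
      linarith
    · rw [PiLp.smul_apply, smul_eq_mul, inv_mul_lt_iff₀ hk1]
      have : (2 : ℝ) ^ (k + 2) = (2 : ℝ) ^ (k + 1) * 2 := by
        rw [← zpow_add_one₀ two_ne_zero]; ring_nf
      linarith


/-- The point `X` with `X₃ > 0` lies in its own dyadic band `2^{k-1} < X₃ < 2^{k+2}`, `k = ⌊log₂ X₃⌋`. -/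
theorem slabExt_mem_band {X : EuclideanSpace ℝ (Fin 3)} (hX : 0 < X 2) :
    (2 : ℝ) ^ (Int.log 2 (X 2) - 1) < X 2 ∧ X 2 < (2 : ℝ) ^ (Int.log 2 (X 2) + 2) := by
  have hm1 := slabExt_zpow_log_le hX
  have hm2 := slabExt_lt_zpow_log_succ (X 2)
  constructor
  · have : (2 : ℝ) ^ (Int.log 2 (X 2) - 1) < (2 : ℝ) ^ Int.log 2 (X 2) :=
      zpow_lt_zpow_right₀ one_lt_two (by omega)
    linarith
  · have : (2 : ℝ) ^ (Int.log 2 (X 2) + 1) < (2 : ℝ) ^ (Int.log 2 (X 2) + 2) :=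
      zpow_lt_zpow_right₀ one_lt_two (by omega)
    linarith

/-- The rescaled point `2^{-⌊log₂ X₃⌋} X` lies in the fundamental band `1 ≤ z < 2`. -/
theorem slabExt_rescale_mem {X : EuclideanSpace ℝ (Fin 3)} (hX : 0 < X 2) :
    1 ≤ (((2 : ℝ) ^ Int.log 2 (X 2))⁻¹ • X) 2 ∧ (((2 : ℝ) ^ Int.log 2 (X 2))⁻¹ • X) 2 < 2 := by
  have hm1 := slabExt_zpow_log_le hX
  have hm2 := slabExt_lt_zpow_log_succ (X 2)
  have hk : 0 < (2 : ℝ) ^ Int.log 2 (X 2) := zpow_pos two_pos _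
  rw [PiLp.smul_apply, smul_eq_mul]
  constructor
  · rw [le_inv_mul_iff₀ hk, mul_one]
    exact hm1
  · rw [inv_mul_lt_iff₀ hk, ← zpow_add_one₀ two_ne_zero]
    exact hm2

/-- The dilation `2^{-k}` maps the band `2^{k-1} < z < 2^{k+2}` into the slab `1/2 < z < 4`. -/
theorem slabExt_mapsTo (k : ℤ) :
    MapsTo (fun Y : EuclideanSpace ℝ (Fin 3) => ((2 : ℝ) ^ k)⁻¹ • Y)
      {Y : EuclideanSpace ℝ (Fin 3) | (2 : ℝ) ^ (k - 1) < Y 2 ∧ Y 2 < (2 : ℝ) ^ (k + 2)}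
      {Y : EuclideanSpace ℝ (Fin 3) | 1 / 2 < Y 2 ∧ Y 2 < 4} := by
  intro Y hY
  obtain ⟨h1, h2⟩ := hY
  have hk : 0 < (2 : ℝ) ^ k := zpow_pos two_pos k
  simp only [mem_setOf_eq, PiLp.smul_apply, smul_eq_mul]
  constructor
  · rw [lt_inv_mul_iff₀ hk]
    rw [zpow_sub_one₀ two_ne_zero] at h1
    linarith
  · rw [inv_mul_lt_iff₀ hk]
    have : (2 : ℝ) ^ (k + 2) = (2 : ℝ) ^ k * 4 := by
      rw [zpow_add₀ two_ne_zero]; norm_num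
    linarith

/-- **Local form.** Near a point of the open half-space the dyadic extension is `f ∘ (2^{-k} •)` with the
FIXED exponent `k = ⌊log₂ X₃⌋` of that point. -/
theorem slabExt_eventuallyEq {α : Type*} (f : EuclideanSpace ℝ (Fin 3) → α)
    (hf : ∀ Y : EuclideanSpace ℝ (Fin 3), 1 / 2 < Y 2 → Y 2 < 2 → f ((2 : ℝ) • Y) = f Y)
    {X : EuclideanSpace ℝ (Fin 3)} (hX : 0 < X 2) :
    (fun Y : EuclideanSpace ℝ (Fin 3) => f (((2 : ℝ) ^ Int.log 2 (Y 2))⁻¹ • Y)) =ᶠ[𝓝 X]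
      fun Y : EuclideanSpace ℝ (Fin 3) => f (((2 : ℝ) ^ Int.log 2 (X 2))⁻¹ • Y) := by
  filter_upwards [(slabExt_isOpen_band _ _).mem_nhds (slabExt_mem_band hX)] with Y hY
  exact slabExt_agree f hf hY.1 hY.2

/-- **Smoothness transfer.** If `f` is `C^∞` on the slab `1/2 < z < 4` and satisfies the dilation relation
there, its dyadic extension is `C^∞` on the open half-space. -/
theorem slabExt_contDiffOn {F' : Type*} [NormedAddCommGroup F'] [NormedSpace ℝ F'] (f : EuclideanSpace ℝ (Fin 3) → F')
    (hfS : ContDiffOn ℝ ((⊤ : ℕ∞) : WithTop ℕ∞) f {Y : EuclideanSpace ℝ (Fin 3) | 1 / 2 < Y 2 ∧ Y 2 < 4})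
    (hf : ∀ Y : EuclideanSpace ℝ (Fin 3), 1 / 2 < Y 2 → Y 2 < 2 → f ((2 : ℝ) • Y) = f Y) :
    ContDiffOn ℝ ((⊤ : ℕ∞) : WithTop ℕ∞) (fun Y : EuclideanSpace ℝ (Fin 3) => f (((2 : ℝ) ^ Int.log 2 (Y 2))⁻¹ • Y))
      {Y : EuclideanSpace ℝ (Fin 3) | 0 < Y 2} := by
  apply contDiffOn_of_locally_contDiffOn
  intro X hX
  have hX' : 0 < X 2 := hX
  set k := Int.log 2 (X 2) with hk
  refine ⟨{Y : EuclideanSpace ℝ (Fin 3) | (2 : ℝ) ^ (k - 1) < Y 2 ∧ Y 2 < (2 : ℝ) ^ (k + 2)}, slabExt_isOpen_band _ _,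
    slabExt_mem_band hX', ?_⟩
  have hcomp : ContDiffOn ℝ ((⊤ : ℕ∞) : WithTop ℕ∞) (f ∘ fun Y : EuclideanSpace ℝ (Fin 3) => ((2 : ℝ) ^ k)⁻¹ • Y)
      {Y : EuclideanSpace ℝ (Fin 3) | (2 : ℝ) ^ (k - 1) < Y 2 ∧ Y 2 < (2 : ℝ) ^ (k + 2)} :=
    hfS.comp (contDiff_const_smul _).contDiffOn (slabExt_mapsTo k)
  refine (hcomp.congr ?_).mono inter_subset_right
  intro Y hY
  exact slabExt_agree f hf hY.1 hY.2

/-- **Derivative transfer.** At a point of the open half-space the derivative of the dyadic extension is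
`2^{-k} • Df (2^{-k} X)`, `k = ⌊log₂ X₃⌋`. -/
theorem slabExt_fderiv {F' : Type*} [NormedAddCommGroup F'] [NormedSpace ℝ F'] (f : EuclideanSpace ℝ (Fin 3) → F')
    (hfS : ContDiffOn ℝ ((⊤ : ℕ∞) : WithTop ℕ∞) f {Y : EuclideanSpace ℝ (Fin 3) | 1 / 2 < Y 2 ∧ Y 2 < 4})
    (hf : ∀ Y : EuclideanSpace ℝ (Fin 3), 1 / 2 < Y 2 → Y 2 < 2 → f ((2 : ℝ) • Y) = f Y)
    {X : EuclideanSpace ℝ (Fin 3)} (hX : 0 < X 2) :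
    fderiv ℝ (fun Y : EuclideanSpace ℝ (Fin 3) => f (((2 : ℝ) ^ Int.log 2 (Y 2))⁻¹ • Y)) X =
      ((2 : ℝ) ^ Int.log 2 (X 2))⁻¹ • fderiv ℝ f (((2 : ℝ) ^ Int.log 2 (X 2))⁻¹ • X) := by
  rw [(slabExt_eventuallyEq f hf hX).fderiv_eq]
  set a : ℝ := ((2 : ℝ) ^ Int.log 2 (X 2))⁻¹ with ha
  -- `f` is differentiable at the rescaled point, which lies in the open slab
  have hmem : a • X ∈ {Y : EuclideanSpace ℝ (Fin 3) | 1 / 2 < Y 2 ∧ Y 2 < 4} := by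
    obtain ⟨h1, h2⟩ := slabExt_rescale_mem hX
    exact ⟨by linarith, by linarith⟩
  have hd : DifferentiableAt ℝ f (a • X) :=
    (hfS.contDiffAt ((slabExt_isOpen_band _ _).mem_nhds hmem)).differentiableAt (by simp)
  have hL : HasFDerivAt (fun Y : EuclideanSpace ℝ (Fin 3) => a • Y)
      (a • ContinuousLinearMap.id ℝ (EuclideanSpace ℝ (Fin 3))) X :=
    (hasFDerivAt_id X).const_smul a
  have hc : HasFDerivAt (fun Y : EuclideanSpace ℝ (Fin 3) => f (a • Y))
      ((fderiv ℝ f (a • X)).comp (a • ContinuousLinearMap.id ℝ (EuclideanSpace ℝ (Fin 3)))) X :=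
    hd.hasFDerivAt.comp X hL
  rw [hc.fderiv]
  ext v
  simp

/-- **Gradient transfer** (scalar case of `slabExt_fderiv`). -/
theorem slabExt_gradient (f : EuclideanSpace ℝ (Fin 3) → ℝ)
    (hfS : ContDiffOn ℝ ((⊤ : ℕ∞) : WithTop ℕ∞) f {Y : EuclideanSpace ℝ (Fin 3) | 1 / 2 < Y 2 ∧ Y 2 < 4})
    (hf : ∀ Y : EuclideanSpace ℝ (Fin 3), 1 / 2 < Y 2 → Y 2 < 2 → f ((2 : ℝ) • Y) = f Y)
    {X : EuclideanSpace ℝ (Fin 3)} (hX : 0 < X 2) :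
    gradient (fun Y : EuclideanSpace ℝ (Fin 3) => f (((2 : ℝ) ^ Int.log 2 (Y 2))⁻¹ • Y)) X =
      ((2 : ℝ) ^ Int.log 2 (X 2))⁻¹ • gradient f (((2 : ℝ) ^ Int.log 2 (X 2))⁻¹ • X) := by
  unfold gradient
  rw [slabExt_fderiv f hfS hf hX, map_smulₛₗ]
  simp

/-- **Stub `stub_slabExtension` (transfer stub of the line `Sketch`, census D1 `SlabExtension`).**
A slab hierarchy `(V, Q, C, F)` on the open slab `1/2 < z < 4` extends to a half-space hierarchy: the witnesses
are the dyadic extensions `X ↦ V (2^{-⌊log₂ X₃⌋} X)`, `X ↦ Q (2^{-⌊log₂ X₃⌋} X)` with the same `C, F`.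
Smoothness, bounds, divergence and the Euler equation transfer through the local form
(`slabExt_contDiffOn`, `slabExt_fderiv`, `slabExt_gradient`: both sides of Euler scale by `2^{-k}`); the
dilation invariance holds by the agreement lemma on the band of `2X`; on `1/2 < z < 4` the extension IS
`(V, Q)` (agreement with `k = 0`), which gives the periodicity and the two flux clauses verbatim. -/
theorem stub_slabExtension :
    (∃ (V : EuclideanSpace ℝ (Fin 3) → EuclideanSpace ℝ (Fin 3)) (Q : EuclideanSpace ℝ (Fin 3) → ℝ) (C F : ℝ),
      ContDiffOn ℝ ((⊤ : ℕ∞) : WithTop ℕ∞) V {Y : EuclideanSpace ℝ (Fin 3) | 1 / 2 < Y 2 ∧ Y 2 < 4} ∧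
      ContDiffOn ℝ ((⊤ : ℕ∞) : WithTop ℕ∞) Q {Y : EuclideanSpace ℝ (Fin 3) | 1 / 2 < Y 2 ∧ Y 2 < 4} ∧
      (∀ X ∈ {Y : EuclideanSpace ℝ (Fin 3) | 1 / 2 < Y 2 ∧ Y 2 < 4}, ‖V X‖ ≤ C ∧ |Q X| ≤ C) ∧
      (∀ X ∈ {Y : EuclideanSpace ℝ (Fin 3) | 1 / 2 < Y 2 ∧ Y 2 < 4},
        ∑ i : Fin 3, (fderiv ℝ V X (EuclideanSpace.single i (1 : ℝ))) i = 0) ∧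
      (∀ X ∈ {Y : EuclideanSpace ℝ (Fin 3) | 1 / 2 < Y 2 ∧ Y 2 < 4}, (fderiv ℝ V X) (V X) + gradient Q X = 0) ∧
      (∀ X : EuclideanSpace ℝ (Fin 3), 1 / 2 < X 2 → X 2 < 2 → V ((2 : ℝ) • X) = V X ∧ Q ((2 : ℝ) • X) = Q X) ∧
      (∀ X : EuclideanSpace ℝ (Fin 3), 1 ≤ X 2 → X 2 ≤ 2 →
        V (X + EuclideanSpace.single 0 (1 : ℝ)) = V X ∧ V (X + EuclideanSpace.single 1 (1 : ℝ)) = V X ∧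
        Q (X + EuclideanSpace.single 0 (1 : ℝ)) = Q X ∧ Q (X + EuclideanSpace.single 1 (1 : ℝ)) = Q X) ∧
      (∫ q in Set.Icc (0 : ℝ) 1 ×ˢ Set.Icc (0 : ℝ) 1, (V !₂[q.1, q.2, (1 : ℝ)]) 2 = 0) ∧ F ≠ 0 ∧
      (∫ q in Set.Icc (0 : ℝ) 1 ×ˢ Set.Icc (0 : ℝ) 1,
        (V !₂[q.1, q.2, (1 : ℝ)]) 2 * (‖V !₂[q.1, q.2, (1 : ℝ)]‖ ^ 2 / 2 + Q !₂[q.1, q.2, (1 : ℝ)]) = F)) →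
    HalfSpaceHierarchy := by
  rintro ⟨V, Q, C, F, h⟩
  obtain ⟨hV, hQ, hB, hdiv, hE, hdil, hper, hmass, hF, hflux⟩ := h
  have hdilV : ∀ Y : EuclideanSpace ℝ (Fin 3), 1 / 2 < Y 2 → Y 2 < 2 → V ((2 : ℝ) • Y) = V Y :=
    fun Y h1 h2 => (hdil Y h1 h2).1
  have hdilQ : ∀ Y : EuclideanSpace ℝ (Fin 3), 1 / 2 < Y 2 → Y 2 < 2 → Q ((2 : ℝ) • Y) = Q Y :=
    fun Y h1 h2 => (hdil Y h1 h2).2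
  -- the rescaled point lies in the slab
  have hS : ∀ X : EuclideanSpace ℝ (Fin 3), 0 < X 2 →
      ((2 : ℝ) ^ Int.log 2 (X 2))⁻¹ • X ∈ {Y : EuclideanSpace ℝ (Fin 3) | 1 / 2 < Y 2 ∧ Y 2 < 4} := by
    intro X hX
    obtain ⟨h1, h2⟩ := slabExt_rescale_mem hX
    exact ⟨by linarith, by linarith⟩
  -- on `1/2 < z < 4` the extension is the original function (agreement with `k = 0`)
  have hagree : ∀ (α : Type) (f : EuclideanSpace ℝ (Fin 3) → α),
      (∀ Y : EuclideanSpace ℝ (Fin 3), 1 / 2 < Y 2 → Y 2 < 2 → f ((2 : ℝ) • Y) = f Y) →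
      ∀ X : EuclideanSpace ℝ (Fin 3), 1 / 2 < X 2 → X 2 < 4 → f (((2 : ℝ) ^ Int.log 2 (X 2))⁻¹ • X) = f X := by
    intro α f hf X h1 h2
    have h := slabExt_agree f hf (k := 0) (X := X) (by norm_num; exact h1) (by norm_num; exact h2)
    simpa using h
  -- the trace at `z = 1` is untouched
  have hpt : ∀ q : ℝ × ℝ, ((2 : ℝ) ^ Int.log 2 ((!₂[q.1, q.2, (1 : ℝ)] : EuclideanSpace ℝ (Fin 3)) 2))⁻¹ •
      (!₂[q.1, q.2, (1 : ℝ)] : EuclideanSpace ℝ (Fin 3)) = !₂[q.1, q.2, (1 : ℝ)] := by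
    intro q
    have h1 : (!₂[q.1, q.2, (1 : ℝ)] : EuclideanSpace ℝ (Fin 3)) 2 = 1 := by simp
    rw [h1, Int.log_one_right, zpow_zero, inv_one, one_smul]
  refine ⟨fun X => V (((2 : ℝ) ^ Int.log 2 (X 2))⁻¹ • X),
    fun X => Q (((2 : ℝ) ^ Int.log 2 (X 2))⁻¹ • X), C, F, ?_⟩
  dsimp only
  refine ⟨slabExt_contDiffOn V hV hdilV, slabExt_contDiffOn Q hQ hdilQ, fun X hX => hB _ (hS X hX),
    ?_, ?_, ?_, ?_, ?_, hF, ?_⟩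
  · -- divergence free
    intro X hX
    have hX' : 0 < X 2 := hX
    simp only [slabExt_fderiv V hV hdilV hX', _root_.smul_apply, PiLp.smul_apply,
      smul_eq_mul, ← Finset.mul_sum]
    rw [hdiv _ (hS X hX'), mul_zero]
  · -- steady Euler: both terms scale by `2^{-k}`
    intro X hX
    have hX' : 0 < X 2 := hX
    rw [slabExt_fderiv V hV hdilV hX', slabExt_gradient Q hQ hdilQ hX', _root_.smul_apply,
      ← smul_add, hE _ (hS X hX'), smul_zero]
  · -- dilation invariance
    intro X hX
    have hX' : 0 < X 2 := hX
    have hm1 := slabExt_zpow_log_le hX'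
    have hm2 := slabExt_lt_zpow_log_succ (X 2)
    have h2X : ((2 : ℝ) • X) 2 = 2 * X 2 := by simp
    have hb1 : (2 : ℝ) ^ (Int.log 2 (X 2) - 1) < ((2 : ℝ) • X) 2 := by
      rw [h2X, zpow_sub_one₀ two_ne_zero]
      nlinarith [zpow_pos (two_pos : (0 : ℝ) < 2) (Int.log 2 (X 2))]
    have hb2 : ((2 : ℝ) • X) 2 < (2 : ℝ) ^ (Int.log 2 (X 2) + 2) := by
      rw [h2X]
      have : (2 : ℝ) ^ (Int.log 2 (X 2) + 2) = 2 * (2 : ℝ) ^ (Int.log 2 (X 2) + 1) := by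
        rw [show Int.log 2 (X 2) + 2 = Int.log 2 (X 2) + 1 + 1 by ring, zpow_add_one₀ two_ne_zero]
        ring
      rw [this]
      linarith
    have key : ∀ (α : Type) (f : EuclideanSpace ℝ (Fin 3) → α),
        (∀ Y : EuclideanSpace ℝ (Fin 3), 1 / 2 < Y 2 → Y 2 < 2 → f ((2 : ℝ) • Y) = f Y) →
        f (((2 : ℝ) ^ Int.log 2 (((2 : ℝ) • X) 2))⁻¹ • ((2 : ℝ) • X)) =
          f (((2 : ℝ) ^ Int.log 2 (X 2))⁻¹ • X) := by
      intro α f hf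
      rw [slabExt_agree f hf hb1 hb2, smul_comm]
      obtain ⟨r1, r2⟩ := slabExt_rescale_mem hX'
      exact hf _ (by linarith) r2
    exact ⟨key _ V hdilV, key _ Q hdilQ⟩
  · -- horizontal periodicity on the band `1 ≤ z ≤ 2`
    intro X h1 h2
    have e0 : (X + EuclideanSpace.single (0 : Fin 3) (1 : ℝ) : EuclideanSpace ℝ (Fin 3)) 2 = X 2 := by simp
    have e1 : (X + EuclideanSpace.single (1 : Fin 3) (1 : ℝ) : EuclideanSpace ℝ (Fin 3)) 2 = X 2 := by simp
    have hXa : 1 / 2 < X 2 := by linarith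
    have hXb : X 2 < 4 := by linarith
    rw [hagree _ V hdilV X hXa hXb, hagree _ Q hdilQ X hXa hXb,
      hagree _ V hdilV _ (by rw [e0]; exact hXa) (by rw [e0]; exact hXb),
      hagree _ V hdilV _ (by rw [e1]; exact hXa) (by rw [e1]; exact hXb),
      hagree _ Q hdilQ _ (by rw [e0]; exact hXa) (by rw [e0]; exact hXb),
      hagree _ Q hdilQ _ (by rw [e1]; exact hXa) (by rw [e1]; exact hXb)]
    exact hper X h1 h2
  · -- zero mass flux through the unit square of `z = 1`
    simp_rw [hpt]
    exact hmass
  · -- the energy flux is the slab's `F`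
    simp_rw [hpt]
    exact hflux

end Summit.AnomalousDissipation.AnomalousDissipation.Theorems.HalfSpaceHierarchy

end
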